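import Literature.IUT.HodgeArakelov.CohomologyAutEquiv
import Literature.IUT.HodgeArakelov.CohomologyLimitKummer

/-!
# An automorphism pair `(α, β)` over `G_k` with `β` trivial on the coefficients FIXES the Kummer classes of the
# constants ([IUTchII] Cor. 1.12 (ii) input: "`ι` fixes the unit classes `M^×_TM(Π)`") — proof companion

Proof-only companion (abc-iut cell, D-0067 wave 4, seat abc-iut-w4-d043 gen 2; L6-lead ruling §F v1.18c (1); SUBDAG
`plan/L6/SUBDAG-IUTchII-Cor-112.md` row Cor-112.ii.r13, input `(hι)`) to abc-iut-L6-t1's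
`CohomologyAutFunctoriality.lean` / `CohomologyAutEquiv.lean` (p412635/p412842: the action `h1LimAut`/`h1LimAutEquiv` of
an automorphism pair `(α, β)` on `lim_K H¹(H|_K, A')` — the model shape of CMR's `ThetaEvaluation.iotaLim`, abc-iut-w5-d072's
`pairRhoLim`) and to abc-iut-w4-d007's `CohomologyLimitKummer.lean` (p416543: the Kummer map `h1LimKummer` into the genuine
limit). No definitions.

S. Mochizuki, *Inter-universal Teichmüller theory II*, kurims manuscript (Dec. 2020), Cor. 1.12 (ii) p. 57 and Rmk.
1.4.1 (ii) p. 28 ("an order two automorphism `ι_Ÿ` of `Ÿ̲_k` lifting `ι_X̲̲`" — over `k`: `ι` lies over `G_k`). Claim key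
`Mochizuki2012` (D-0012, DISPUTED); classical Kummer theory [cite: NeukirchSchmidtWingberg2008, I §5]; nothing here takes a
side on [IUTchIII] Cor. 3.12.

PROVED, for an automorphism pair `(α, β)` of `(Π, G')` compatible with `φ` such that
(`hαA`) `α⁻¹(x)` and `x` act identically on the discrete `Π`-module `A` (at the model: `α` lies OVER `G_k` — `q ∘ α = q` —
and `Ker(q)` acts trivially on `k̄`), and (`hβ`) `β` is the IDENTITY on the coefficients `A'` (at the model: `ι` acts
trivially on `(l·Δ_Θ) ⊆ Δ_Θ ≅ Ẑ(1)`, the inversion acting by `(−1)² = 1` on `∧² T(E)`):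
* `autMap_kummerContClass` — the transport `autMap α β` of the continuous Kummer class of `b` at level `H ⊓ K` is the
  Kummer class of `b` at level `H ⊓ α(K)` (the Kummer cocycle only sees the action on the roots, and `β ∘ c = c`);
* **`h1LimAut_h1LimKummer`**, **`h1LimAutEquiv_h1LimKummer`** — `(α, β)` FIXES `κ_H(b)` in `lim_K H¹(H|_K, A')` for
  every `b ∈ A`: the input `(hι)` of Cor. 1.12 (ii) ("`ι` fixes `M^×_TM(Π)` up to torsion") holds ON THE NOSE for Kummer
  classes of constants under `(hαA)`, `(hβ)`.
Typed ≠ discharged for `(hαA)`, `(hβ)` at the model.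
-/

noncomputable section

namespace Literature.IUT.HodgeArakelov

open Literature.AnabelianGeometry.EtaleTheta CohomologySystemOfContH1

namespace CohomologySystemOfContH1

variable {P : TopGroup.{0}} {G' : Type} [Group G'] [TopologicalSpace G'] [IsTopologicalGroup G']
  (φ : P →* G') (A' : Subgroup G') [A'.Normal] [IsMulCommutative A'] (H : Subgroup P)
  {A : Type} [CommGroup A] [MulDistribMulAction P A] [TopologicalSpace A]
  (c : CyclotomeCoefficients φ A' A)
  (α : P ≃ₜ* P) (β : G' ≃ₜ* G') (hφ : ∀ g, β (φ g) = φ (α g))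
  (hA : ∀ a : G', a ∈ A' ↔ β a ∈ A') (hH : ∀ x, x ∈ H ↔ α x ∈ H)

omit [TopologicalSpace A] in
/-- If `α⁻¹(x)` and `x` act identically on `A`, an element fixed by `H ⊓ K` is fixed by `H ⊓ α(K)`.
[cite: NeukirchSchmidtWingberg2008, I §5] -/
theorem mem_fixedPoints_mapAut (hH : ∀ x, x ∈ H ↔ α x ∈ H) (hαA : ∀ (x : P) (b : A), α.symm x • b = x • b)
    {K : Subgroup P} {b : A} (hb : b ∈ MulAction.fixedPoints ↥(H ⊓ K) A) :
    b ∈ MulAction.fixedPoints ↥(H ⊓ K.map α.toMulEquiv.toMonoidHom) A := fun x => by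
  change (x : P) • b = b
  rw [← hαA]
  exact hb ⟨α.symm x, symm_mem_inf H α hH K x x.2⟩

/-- The transport along `(α, β)` of the continuous Kummer class of `b` at level `H ⊓ K` is the Kummer class of `b`
at level `H ⊓ α(K)` — the cocycle `h ↦ c((h·β_n/β_n)_n)` sees only the action on the roots (`hαA`) and `β ∘ c = c`
(`hβ`). [cite: NeukirchSchmidtWingberg2008, I §5] -/
theorem autMap_kummerContClass (hαA : ∀ (x : P) (b : A), α.symm x • b = x • b)
    (hβ : ∀ a : G', a ∈ A' → β a = a) {K : Subgroup P} {b : A} (x : RootSystem b)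
    (hb : b ∈ MulAction.fixedPoints ↥(H ⊓ K) A) (hx : ∀ n : ℕ+, IsOpen (MulAction.stabilizer P (x.root n) : Set P)) :
    ContH1Aut.autMap φ A' α β hφ (fun a ha => (hA a).mp ha) (symm_mem_inf H α hH K)
        (c.kummerContClass (H ⊓ K) x hb hx) =
      c.kummerContClass (H ⊓ K.map α.toMulEquiv.toMonoidHom) x
        (mem_fixedPoints_mapAut H α hH hαA hb) hx := by
  change QuotientGroup.mk (ContH1Aut.autCocycle φ A' α β hφ (fun a ha => (hA a).mp ha) (symm_mem_inf H α hH K)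
      (c.kummerContCocycle (H ⊓ K) x hb hx)) =
    QuotientGroup.mk (c.kummerContCocycle (H ⊓ K.map α.toMulEquiv.toMonoidHom) x
      (mem_fixedPoints_mapAut H α hH hαA hb) hx)
  congr 1
  apply Subtype.ext
  funext y
  apply Subtype.ext
  rw [ContH1Aut.coe_autCocycle_apply, CyclotomeCoefficients.kummerContCocycle_apply,
    CyclotomeCoefficients.kummerContCocycle_apply, hβ _ (c.hom _).2]
  congr 2
  apply Subtype.ext
  funext n
  change α.symm (y : P) • x.root n / x.root n = (y : P) • x.root n / x.root n
  rw [hαA]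

variable (hopen : ∀ b : A, IsOpen (MulAction.stabilizer P b : Set P)) [RootableBy A ℕ]
  (hfi : ∀ b : A, (MulAction.stabilizer P b).FiniteIndex)

/-- **The automorphism pair `(α, β)` fixes the Kummer class of every constant** in `lim_K H¹(H|_K, A')`:
`h1LimAut α β (κ_H b) = κ_H b` — the input `(hι)` of [IUTchII] Cor. 1.12 (ii) for Kummer classes of units, on the
nose, under `(hαA)` (`α` over `G_k`) and `(hβ)` (`β` trivial on the coefficients). [cite: Mochizuki2012, Cor 1.12 (ii) p.57] -/
theorem h1LimAut_h1LimKummer (hαA : ∀ (x : P) (b : A), α.symm x • b = x • b)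
    (hβ : ∀ a : G', a ∈ A' → β a = a) (b : A) :
    h1LimAut φ A' H α β hφ (fun a ha => (hA a).mp ha) hH (Multiplicative.toAdd (h1LimKummer φ A' H c hopen hfi b)) =
      Multiplicative.toAdd (h1LimKummer φ A' H c hopen hfi b) := by
  have hb := mem_fixedPoints_stabIdx H hopen hfi b
  have h1 := h1LimKummer_eq_h1Of_kummerContClass φ A' H c hopen hfi b (stabIdx hopen hfi b) hb
    (RootSystem.ofRootableBy b)
  have h2 := h1LimKummer_eq_h1Of_kummerContClass φ A' H c hopen hfi b (Idx.mapAut α (stabIdx hopen hfi b))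
    (mem_fixedPoints_mapAut H α hH hαA hb) (RootSystem.ofRootableBy b)
  conv_lhs => rw [h1, toAdd_ofAdd, h1LimAut_of, toMul_ofMul,
    autMap_kummerContClass φ A' H c α β hφ hA hH hαA hβ]
  rw [h2, toAdd_ofAdd]
  rfl

/-- The same for abc-iut-L6-t1's additive automorphism `h1LimAutEquiv` (= CMR's `iotaLim` / abc-iut-w5-d072's
`pairRhoLim` at the model pointed-inversion pair). [cite: Mochizuki2012, Cor 1.12 (ii) p.57] -/
theorem h1LimAutEquiv_h1LimKummer (hαA : ∀ (x : P) (b : A), α.symm x • b = x • b)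
    (hβ : ∀ a : G', a ∈ A' → β a = a) (b : A) :
    h1LimAutEquiv φ A' H α β hφ hA hH (Multiplicative.toAdd (h1LimKummer φ A' H c hopen hfi b)) =
      Multiplicative.toAdd (h1LimKummer φ A' H c hopen hfi b) := by
  rw [h1LimAutEquiv_apply]
  exact h1LimAut_h1LimKummer φ A' H c α β hφ hA hH hopen hfi hαA hβ b

/-- Hence `(α, β)` fixes (on the nose, so a fortiori up to torsion) every element of the `H`-Kummer image of a subgroup
`U ≤ A` (the unit classes `M^×_TM(Π)` of the first line). [cite: Mochizuki2012, Cor 1.12 (ii) p.57] -/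
theorem h1LimAutEquiv_eq_self_of_mem_kummer (hαA : ∀ (x : P) (b : A), α.symm x • b = x • b)
    (hβ : ∀ a : G', a ∈ A' → β a = a) (U : Subgroup A) {y : h1Lim φ A' H ⊥}
    (hy : y ∈ (AddSubgroup.toSubgroup.symm (U.map (h1LimKummer φ A' H c hopen hfi)) : AddSubgroup (h1Lim φ A' H ⊥))) :
    h1LimAutEquiv φ A' H α β hφ hA hH y = y := by
  obtain ⟨u, -, huy⟩ := Subgroup.mem_map.mp hy
  have : y = Multiplicative.toAdd (h1LimKummer φ A' H c hopen hfi u) := by rw [huy]; rfl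
  rw [this]
  exact h1LimAutEquiv_h1LimKummer φ A' H c α β hφ hA hH hopen hfi hαA hβ u

end CohomologySystemOfContH1

end Literature.IUT.HodgeArakelov
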